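import Mathlib
import HarnessLib
import HarnessLib.Audit
import Summits.QuantumFields.Statement
import Summits.QuantumFields.YangMills.Theses.UnitScaleTilt
import Literature.MathematicalPhysics.QuantumFieldTheory.Balaban1983to89.T3YM3TorusStatement
import HarnessLib.Audit.Status.Attr

/-!
Route: ModerateWindow

# Route ModerateWindow — A windowed sub-Gaussian moment bound at the running scale closes the
history tail

LINE (D-0145 ideator seat ym-r3-idea-2 g4, lens «nearmiss»; bears_on LADDER-YM rung R3 = leaf
`T3YM3TorusStatement.YM3TorusSU2` via
crux stmt-QuantumFields-19936 `UnitScaleTilt.HistoryTailL`; no summit and no rung is proved by this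
line). It suffices to show
X = WindowMGFL: for every block size L there is ONE window exponent ε > 0 such that, for every
family F (F.L = L) and all small γ,
the normalised block-averaged plaquette deviation Y = dist1(Ū^j(∂p))/g_(K−j) (g_i = √(γL^(−i)) =
β_i^(−1/2)) of every height
1 ≤ j ≤ K of every cut-off K satisfies the SUB-GAUSSIAN MOMENT BOUND ∫ e^(tY) dGibbs_K ≤
D·β_(K−j)^A·e^(H t²) ONLY on the
MODERATE-DEVIATION WINDOW 0 ≤ t ≤ β_(K−j)^ε (one (H, D, A) per family and coupling; nothing is asked
beyond the window, i.e. about the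
far tail). Chernoff at t = min(p/(2H), β^ε) and the elementary (1 + ½log β)^(p₀) ≤ M_ε·β^ε give the
per-plaquette Gaussian schema
C·β^A·e^(−c·p(g)²) of the tree, hence 19936; the residual cruxes are the parent's stmt-19200 /
stmt-20520, restated byte-identically.
Lean: `MinimiserStabilityRegPr → FluctuationComparisonRegPrIntL → WindowMGFL → HistoryTailOfWindow →
Literature.MathematicalPhysics.QuantumFieldTheory.Balaban1983to89.T3YM3TorusStatement.YM3TorusSU2`

## Assembly
Pure logic on top of the parent's deciding theorem: `closes h200 h201 hX hG := UnitScaleTilt.closes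
h200 h201 (hG hX)` (glue8.lean,
certified native) — the support item turns WindowMGFL into (the body of) HistoryTailL, and the two
residual cruxes are the parent's
other two hypotheses (same constants by definitional unfolding). The Assembly item restates the
chain; it is proved in Sketch8.lean
(`assembly_proof`) and is landed as `Theorems/ModerateWindowAssembly.lean` right after open.

CLOSES_TARGET: closes rung R3 of QuantumFields: Literature.MathematicalPhysics.QuantumFieldTheory.Balaban1983to89.T3YM3TorusStatement.YM3TorusSU2 (D-0061; not the summit Statement) — the deciding theorem of this route concludes that registered leaf instead of the Statement decl `YangMills` (class rung: servable and labelled, never counted as concluding the summit Statement).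

Rationale: WHY THIS LINE. NEAR-MISS WITH TWO NAMED DEFICITS. The tree's concentration-language interface for
this crux,
`Theorems.SmallFieldWideningLargeFieldMassRefinementTailSubGaussianRung.averagedTailAt_of_subGaussianMGF`,
asks for a GLOBAL sub-Gaussian
MGF (all t ≥ 0) with K-uniform (σ, M) and NO prefactor; its own HONEST SCOPE records deficit (i):
already the landed bare-height
chessboard tail `T3FinestHeightTail.gibbsK_real_not_plaqSmall_le` has prefactor (√β_K)^9, so no
K-uniform moment bound follows; we add
deficit (ii): global sub-Gaussianity forces GAUSSIAN FAR TAILS e^(−x²/2σ²) for all x, which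
large-field domination (towers of marginal
finer levels) makes implausible and which the union bound never uses — the Chernoff parameter
actually needed at height h is
t* = p(g_h)/(2H) = polylog(β_h) ≪ β_h^ε. The single input to improve is therefore the t-RANGE (plus
the prefactor), and the windowed
bound is precisely the STATULEVIČIUS / CRAMÉR moderate-deviation condition of the method of
cumulants: |κ_k(Y)| ≤ k!·H^k·Δ^(2−k) with
Δ = β^ε is equivalent (Cauchy estimates on the disc |t| ≤ Δ) to analyticity and quadratic
boundedness of the sourced free energy
log ∫e^(tY)dGibbs_K on the window [doi:10.1214/22-ps7 = arXiv:2102.01459 §2–3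
(Rudzkis–Saulis–Statulevičius lemma); Saulis–Statulevičius
1991, cited p.23 of paper:arxiv-2304.00876] — and analyticity of a partition function with a BOUNDED
local source in a disc whose radius
is set by the small-field constraint is the canonical output of a convergent cluster /
renormalisation-group expansion
[book:friedli2017-statistical-mechanics-lattice-systems-concrete-mathematical-introduc p.237;
Balaban1988Convergent; Balaban1985UV3 (41),(71)].
Imported from probability: the moderate-deviation window and its Chernoff calculus; from
constructive QFT: sourced analyticity. What it
does that the listed routes do not: no line on 19936 localises the demand in the LAPLACE variable —
CoarseStiffnessTail tilts the
EXTENSIVE sum of capped plaquette energies, FibreConvexityTail/Herbst and the SmallFieldWidening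
interface are global in t, StretchedTail
(this seat's LINE 7) weakens the tail CLASS globally instead; here the far tail is simply not an
obligation. Honest nesting: WindowMGFL
at t = 1 gives StretchedTail.OrliczTailL with α = 1 (so this line bets more than LINE 7), the
converse fails; the lever differs
(window + Gaussian rate + volume/coupling gain Δ = β^ε, iterable under block-averaging steps since
variance proxies add).

RANKED CRUXES. #2 WindowMGFL (crux) — WINDOWED SUB-GAUSSIAN MGF AT THE RUNNING SCALE: ∀ L ∃ ε > 0 ∃
0 < γ₁ ≤ 1 ∀ F (F.L = L), 0 < γ ≤ γ₁ ∃ H > 0, D ≥ 0, A ∀ K, 1 ≤ j ≤ K, ∀ plaquettes p of height j, ∀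
t with 0 ≤ t ≤ β_(K−j)^ε: ∫ exp(t·dist1(Ū^j(∂p))/√(γL^(−(K−j)))) dGibbs_K ≤ D·β_(K−j)^A·exp(H·t²)
(Ū^j = j-fold Bałaban block average with the printed SU(2) loop average ℰp; β_i = (γL^(−i))⁻¹; the
integrand is bounded and measurable, so no integrability clause is needed). [difficulty: XL] (why it
might fail: H must be K- and height-uniform on the whole window: at depth j > K/2 the j integrated
levels may inflate the variance proxy (log-corrections to ⟨Y²⟩ from 1/r³ curvature correlations), or
analyticity in t may stop at radius polylog(β) < β^ε.) [Balaban1985UV3, Balaban1988Convergent,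
doi:10.1214/22-ps7, arXiv:2102.01459]
#3 FluctuationComparisonRegPrIntL (crux) — RESIDUAL (shared item stmt-QuantumFields-20520 of
route-QuantumFields-UnitScaleTilt, restated byte-identically; not this line's lever): the
interior-excised fluctuation comparison of the two RG runs at every co-height. [difficulty: XL] (why
it might fail: Cross-cut-off content unprinted for non-abelian d=3: the King-slack two-run row at
every co-height must come from the (α) record; a failure in the window's body is not rescued by any
excision ratio c<1.) [Balaban1985UV3, King1986, Balaban1988Convergent, Balaban1989LargeFieldII]
#4 MinimiserStabilityRegPr (crux) — RESIDUAL (shared item stmt-QuantumFields-19200 of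
route-QuantumFields-UnitScaleTilt, restated byte-identically; not this line's lever): stability of
the printed regular minimiser across one cut-off step. [difficulty: XL] (why it might fail:
Uniformly over all small V the errors along the printed minimiser (interpolation ≈
B₃²b₀²p(g)²L^(K(5/m−2)), cubic averaging error) must be summable, m ≥ 3; INTERP unprinted, AVG-INEQ
printed only for Federbush's averaging.) [Balaban1985UV3, King1986]
#9 HistoryTailOfWindow (support) — THE GLUE (provable now, M): WindowMGFL → the body of
UnitScaleTilt.HistoryTailL. Given L take ε, γ₁ from WindowMGFL; given (b₁, p₁) put b₀ := max b₁ 1,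
p₀ := max p₁ 3 (BEFORE m); for (F, γ) take (H, D, A). Per plaquette, Markov/Chernoff on the window:
Gibbs_K(θBal(K−j) ≤ dist1(Ū^j(∂p))) ≤ D·β^A·exp(H t² − t·p) for every 0 ≤ t ≤ β^ε, with p = B10.pFun
b₀ p₀ (g_(K−j)) = b₀(1 + ½ log β_(K−j))^(p₀) (θBal(i) = g_i·p(g_i)); since β ≥ 1 (γ ≤ 1) and log β ≤
β^a/a (Mathlib `Real.log_le_rpow_div`, a = ε/p₀) we have p ≤ M·β^ε with M = b₀(1 + 1/(2a))^(p₀), so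
t := p/max(2H, M) lies in the window and gives exponent ≤ −c·p² with c = 1/(2·max(2H, M)) > 0; this
is the hypothesis of the landed schema `T3AveragedTailProfile.historyTailAt_of_perPlaquette` (C :=
D, A, c; needs 0 < γ ≤ 1, 0 < b₀, 1 ≤ p₀), which returns HistoryTailAt F γ b₀ p₀ m for every m ≥ 1.
Integrability of the bounded integrand: landed
`LargeFieldMassRefinementTailSubGaussianRung.integrable_exp_mul_dist1_iter`. [difficulty:
provable-now] [Balaban1985UV3, doi:10.1214/22-ps7]

TWO-LAYER PLAN. WindowMGFL ⇐ (W1) FINE HALF 2j ≤ K: the windowed bound with few integrated levels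
(capped quadratic tilt at scale g_(K−j), the regime
of the listed levers) → (W2) DEEP HALF K < 2j: ONE-STEP TRANSFER of the windowed bound under a
block-averaging step (variance proxies
add: H_(j+1) ≤ H_j·(1 + c·L^(−(K−j))) from sourced analyticity of the one-step fluctuation
integral), iterated → glue W1 → W2 →
WindowMGFL (monotone closure in ε, H, A makes the join pure logic; see the birth skeleton). Nothing
filed now.

KILL CRITERIA. Refutation of WindowMGFL — a family and a height sequence along which, for every ε >
0, sup over the window of
(log ∫e^(tY) − A log β)/t² is unbounded in K (e.g. a proved variance ⟨Y²⟩ ≳ j·log L growing with the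
depth, or a real singularity of
the sourced free energy at |t| = polylog β) — closes the route `refuted:WindowMGFL`; it would also
refute every global sub-Gaussian
interface (SmallFieldWidening's) while leaving StretchedTail alive. A proof of 19936 through the
parent's (α) lane or a sibling line
moots the route (superseded). Refutation of a residual crux kills the parent too.

NOT DECOMPOSED YET. The fine/deep split (Two-layer plan), the values of ε and H, the dependence of
(H, D, A) on (F, γ), the j = 0 height (landed:
`T3FinestHeightTail`, `T3BareTailProfile.bareTailAt`, where the windowed bound holds for ALL t with
A = 9/2 — the BC5 rung), and the
cumulant (Statulevičius) reformulation are deliberately not items.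

CHEAPEST FALSIFIER. INSTRUMENT ROW (engines ym-r3-instr, JOB-D-type Monte-Carlo data): at L = 3,
fixed γ, depths j ≈ K/2 and j = K−1 for K = 4..7,
estimate the empirical log-MGF Λ_K(t) = log mean exp(t·Y) of Y = dist1(Ū^j(∂p))/g_(K−j) on a grid 0
≤ t ≤ 2·p(g_(K−j)); WindowMGFL
predicts Λ_K(t)/t² bounded uniformly in K on that grid (after subtracting A·log β); growth of sup_t
Λ_K(t)/t² with K at fixed relative
depth refutes the key lemma, and the SAME run measures ⟨Y²⟩ versus depth (the log-correction
scenario of «why it might fail»). In Lean: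
the probe `WindowMGFL → YM3TorusSU2` by exact?/simp/aesop must fail (BC2) — it does (bc/ files).

DEFINITION REQUESTS. None: the windowed moment bound is an explicit exponential integral over
existing declarations (rpow window `β ^ ε`).

Novelty: Searches (2026-08-28): lit search --hybrid "cumulants Statulevicius moderate deviations Gibbs field
cluster expansion" (8: Friedli–Velenik
pp.599–602, Montvay–Münster p.153, Glimm–Jaffe p.187 — CLT/analyticity, no gauge tail); lit search
"method of cumulants normal approximation
Döring Jansen Schubert" --source all (local 6 citing papers incl. paper:arxiv-2304.00876; remote
doi:10.1214/22-ps7 = arXiv:2102.01459);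
lit galaxy search "Rudzkis|Statulevi" --star pdf (10; Bickel–Levina covariance thresholding
pdf:-2887627460547443340 uses the RSS lemma; no
gauge theory); lit galaxy search "Statulevičius condition|moderate deviations|method of cumulants"
--star all (22 rows, none lattice-gauge);
earlier this seat: galaxy "stretched exponential tail|Orlicz norm|sub-Weibull" --star all (24, none
gauge), vsearch "infrared bounds lattice
gauge plaquette" (10, textbooks only); ledger negatives --problem QuantumFields (7, no tail
statement); tree rg over Theses/ (13 levers).
Nearest prior art found: Balaban1985UV3, doi:10.1214/22-ps7, arXiv:2102.01459 — Bałaban's Gaussian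
rate (71) inside the (α) representation;
the method of cumulants / Rudzkis–Saulis–Statulevičius lemma (cumulant decay with parameter Δ ⇒
Gaussian moderate deviations for x ≤ Δ^(1/3)…Δ)
never applied to lattice gauge block observables; in the tree the global sub-Gaussian interface
`averagedTailAt_of_subGaussianMGF`.
Delta: the first line on 19936 that asks for Gaussian behaviour ONLY on the moderate-deviation
window t ≤ β  [refs: 10.1214/22-ps7, 2102.01459, paper:arxiv-2304.00876, doi:10.1214/22-ps7]

Barriers (technique_class: moderate-deviations, cumulant-method, union-bound, rg-output): - technique_class: moderate-deviations, cumulant-method, union-bound, rg-output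
- Literature.Barriers.QuantumFields.UVStabilityNonUniqueness: outside — WindowMGFL is a bound under
the fixed Wilson–Gibbs law of each
  cut-off K; no continuum limit or uniqueness is asserted; the leaf is the rung's RECORD statement
reached through the parent's closes.
- Literature.Barriers.QuantumFields.FixedCouplingUltralocality: outside — the scale g_(K−j) and the
window β_(K−j)^ε RUN with the height;
  nothing is claimed about a fixed-coupling continuum two-point function.
- Literature.Barriers.QuantumFields.RegularisationDichotomy: outside — one regularisation (Wilson
action, Bałaban averaging with the printed
  ℰp) throughout; no comparison across regularisations.
- Literature.Barriers.QuantumFields.PerturbativeInvisibility: the bet — perturbation theory in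
g_(K−j) predicts H ≈ 1 but certifies nothing;
  the windowed bound is a non-perturbative statement whose natural proof is a convergent (not
asymptotic) expansion with a bounded source.
- Negatives index: the 7 refuted QuantumFields statements (items 15826, 18944, 14958, 9665, 9494,
9599, 9603) concern mirror/RP
  families, cut-off Rényi rates and Schwinger-function witnesses; none is a moment or tail bound for
averaged fields; WindowMGFL implies none.

sub-problem: YangMills · status: draft · opened planner-ym-r3-idea-2-g4-0 2026-08-28T12:23:14Z · rev 0 · ledger route-QuantumFields-ModerateWindow
GENERATED by the gate from the ledger (D-0016/17). Provers cite these decls: `theorem foo : Summit.QuantumFields.YangMills.Theses.ModerateWindow.<Decl> := …` in Summits/QuantumFields/YangMills/Theorems/<Name>.lean.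
-/

namespace Summit.QuantumFields.YangMills.Theses.ModerateWindow

open scoped BigOperators Topology Manifold Classical MeasureTheory ProbabilityTheory Matrix InnerProductSpace ComplexConjugate ContinuousMap
open Filter Set Function TopologicalSpace MeasureTheory

attribute [summit_statement] _root_.YangMills
attribute [summit_statement] _root_.Literature.MathematicalPhysics.QuantumFieldTheory.Balaban1983to89.T3YM3TorusStatement.YM3TorusSU2

/-- item stmt-QuantumFields-27839 · crux · rank 2 · open · by planner
why it might fail: H must be K- and height-uniform on the whole window: at depth j > K/2 the j integrated levels may inflate the variance proxy (log-corrections to ⟨Y²⟩ from 1/r³ curvature correlations), or analyticity in t may stop at radius polylog(β) < β^ε.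
sources: Balaban1985UV3, Balaban1988Convergent, doi:10.1214/22-ps7, arXiv:2102.01459
[crux] WINDOWED SUB-GAUSSIAN MGF AT THE RUNNING SCALE: ∀ L ∃ ε > 0 ∃ 0 < γ₁ ≤ 1 ∀ F (F.L = L), 0 < γ
≤ γ₁ ∃ H > 0, D ≥ 0, A ∀ K, 1 ≤ j ≤ K, ∀ plaquettes p of height j, ∀ t with 0 ≤ t ≤ β_(K−j)^ε: ∫
exp(t·dist1(Ū^j(∂p))/√(γL^(−(K−j)))) dGibbs_K ≤ D·β_(K−j)^A·exp(H·t²) (Ū^j = j-fold Bałaban block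
average with the printed SU(2) loop average ℰp; β_i = (γL^(−i))⁻¹; the integrand is bounded and
measurable, so no integrability clause is needed). [difficulty: XL] -/
@[route_item "route-QuantumFields-ModerateWindow", crux]
def WindowMGFL : Prop :=
  open Literature.MathematicalPhysics.QuantumFieldTheory.Balaban1983to89 Literature.MathematicalPhysics.QuantumFieldTheory.Balaban1983to89.T3ContinuumYM3Torus in ∀ (L : ℕ), ∃ ε : ℝ, 0 < ε ∧ ∃ γ₁ : ℝ, 0 < γ₁ ∧ γ₁ ≤ 1 ∧ ∀ (F : T3Family) (γ : ℝ), F.L = L → 0 < γ → γ ≤ γ₁ → ∃ (H D : ℝ) (A : ℕ), 0 < H ∧ 0 ≤ D ∧ ∀ (K j : ℕ), 1 ≤ j → j ≤ K → ∀ (p : Plaq (F.P K) j) (t : ℝ), 0 ≤ t → t ≤ (F.scheme T3UnitLawDensityEML.ℰp γ).β (K - j) ^ ε → ∫ U, Real.exp (t * (GaugeGroup.dist1 (GaugeField.plaqHol (Averaging.iter (fun i => BlockAveraging.blockAvg (P := F.P K) (j := i) T3UnitLawDensityEML.ℰp) j U) p) / Real.sqrt (γ * ((F.L : ℝ)⁻¹)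 ^ (K - j)))) ∂(T3UnitScaleTilt.gibbsK F T3UnitLawDensityEML.ℰp γ K) ≤ D * (F.scheme T3UnitLawDensityEML.ℰp γ).β (K - j) ^ A * Real.exp (H * t ^ 2)

/-- item stmt-QuantumFields-20520 · crux · rank 3 · open · by operator
why it might fail: Cross-cut-off content unprinted for non-abelian d=3: the King-slack two-run row at every co-height must come from the (α) record; a failure in the window's body is not rescued by any excision ratio c<1.
sources: Balaban1985UV3, King1986, Balaban1988Convergent, Balaban1989LargeFieldII
[crux] K1b-INT (E-INT interior excision of FluctuationComparisonRegPrL, OWNER RULING g22-№3 §B +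
ADDENDUM 1; card C8 `edge-band-to-the-tail`): for every L there are an EXCISION RATIO 0 < c ≤ 1 and
THRESHOLDS (b₁, p₁) such that for every profile (b₀, p₀) with b₁ ≤ b₀, p₁ ≤ p₀, 0 < b₀, 2 < p₀ there
is ε₁ > 0 such that for every 0 < ε₀ ≤ ε₁ there is m₀ such that for every m ≥ m₀ there is a
volume-uniform γ₁ > 0 such that for every T3Family F with F.L = L and 0 < γ ≤ γ₁,
`T3InteriorExcision.FluctuationComparisonRegPrIntAt F γ b₀ p₀ m c ε₀`: a.e. on the SHRUNK window
`PlaqSmall (θBal L γ (c·b₀) p₀ (K/m))` both restricted height densities of runs K and K+1 on the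
histGood events at the ORIGINAL profile (b₀, p₀) are positive and log ρ + β·minActionRegPr of the
two runs agree modulo constants κ_K up to summable r_K (same body as FluctuationComparisonRegPrAt;
only the a.e. guard is the c-window). FORMALLY WEAKER than FluctuationComparisonRegPrL (c = 1;
window monotone in b₀: `θBal_mono_b`), NO edge clause (the band {θ(c·b₀)-large, θ(b₀)-small} is
charged to HistoryTailL, whose profile floor absorbs the rescaling:
`T3InteriorExcision.unitTiltTail_of_interior`), and on the c-window print's χ -/
@[route_item "route-QuantumFields-ModerateWindow", crux]
def FluctuationComparisonRegPrIntL : Prop :=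
  open Literature.MathematicalPhysics.QuantumFieldTheory.Balaban1983to89 Literature.MathematicalPhysics.QuantumFieldTheory.Balaban1983to89.T3ContinuumYM3Torus in ∀ (L : ℕ), ∃ (c b₁ p₁ : ℝ), 0 < c ∧ c ≤ 1 ∧ ∀ (b₀ p₀ : ℝ), b₁ ≤ b₀ → p₁ ≤ p₀ → 0 < b₀ → 2 < p₀ → ∃ ε₁ : ℝ, 0 < ε₁ ∧ ∀ (ε₀ : ℝ), 0 < ε₀ → ε₀ ≤ ε₁ → ∃ m₀ : ℕ, ∀ (m : ℕ), m₀ ≤ m → ∃ γ₁ : ℝ, 0 < γ₁ ∧ ∀ (F : T3Family) (γ : ℝ), F.L = L → 0 < γ → γ ≤ γ₁ → T3InteriorExcision.FluctuationComparisonRegPrIntAt F γ b₀ p₀ m c ε₀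

/-- item stmt-QuantumFields-19200 · crux · rank 4 · open · by operator
why it might fail: Uniformly over all small V the errors along the printed minimiser (interpolation ≈ B₃²b₀²p(g)²L^(K(5/m−2)), cubic averaging error) must be summable, m ≥ 3; INTERP unprinted, AVG-INEQ printed only for Federbush's averaging.
sources: Balaban1985UV3, King1986
[crux] K1aR-pr (E-min at the minimum over PRINT'S regular space (6) of Balaban1985Variational IN
FULL — both clauses of (2): small plaquette variables AND small covariant divergence
Balaban1985RegularSpaces (1.9); replaces MinimiserStability stmt-QuantumFields-19822; supersedes
children-v2's plaquette-only MinimiserStabilityReg, which needed the unprinted gap G-K1aR-1 on top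
of [7] Thm 1) — for every block size L there is ε₁(L) > 0 (the uniqueness radius a₀ of
Balaban1985Variational Thm 1, «depends on d and L only») such that for every 0 < ε₀ ≤ ε₁, all
sufficiently large m ≥ m₀(L, ε₀), every profile (b₀, p₀) and all 0 < γ ≤ γ₁(L, ε₀, m, b₀, p₀), every
T3Family F with F.L = L: `MinimiserStabilityRegPrAt F γ b₀ p₀ m ε₀` (tree module
`T3PrintedRegularMinimiser` = `BgStabilityAt` at the printed backgrounds `bgRegPr`/`bgRegPr'`) —
summable r_K ≥ 0 and constants κ_K with, for every K and EVERY θBal(⌊K/m⌋)-small field V on the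
comparison lattice, |β_{K+1}·minActionRegPr_{K+1}(V) − β_K·minActionRegPr_K(V) − κ_K| ≤ r_K (κ
idle), where minActionRegPr_K(V) = inf of the Wilson action over run K's fibre of V ∩ {|U(∂p) − 1| <
ε₀L^{-2(K−⌊K/m⌋)} ∀p} ∩ {‖(D^{1*}_U ∂U)(b)‖ < ε₀L^{-3(K−⌊K/m⌋)} ∀b} (d -/
@[route_item "route-QuantumFields-ModerateWindow", crux]
def MinimiserStabilityRegPr : Prop :=
  open Literature.MathematicalPhysics.QuantumFieldTheory.Balaban1983to89 Literature.MathematicalPhysics.QuantumFieldTheory.Balaban1983to89.T3ContinuumYM3Torus in ∀ (L : ℕ), ∃ ε₁ : ℝ, 0 < ε₁ ∧ ∀ (ε₀ : ℝ), 0 < ε₀ → ε₀ ≤ ε₁ → ∃ m₀ : ℕ, ∀ (m : ℕ), m₀ ≤ m → ∀ (b₀ p₀ : ℝ), 0 < b₀ → 2 < p₀ → ∃ γ₁ : ℝ, 0 < γ₁ ∧ ∀ (F : T3Family) (γ : ℝ), F.L = L → 0 < γ → γ ≤ γ₁ → T3PrintedRegularMinimiser.MinimiserStabilityRegPrAt F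 γ b₀ p₀ m ε₀

/-- item stmt-QuantumFields-27840 · support · rank 9 · closed · proved by Summit.QuantumFields.YangMills.Theorems.ModerateWindowHistoryTailOfWindow.historyTailOfWindow (prover) · by planner
sources: Balaban1985UV3, doi:10.1214/22-ps7
[support] THE GLUE (provable now, M): WindowMGFL → the body of UnitScaleTilt.HistoryTailL. Given L
take ε, γ₁ from WindowMGFL; given (b₁, p₁) put b₀ := max b₁ 1, p₀ := max p₁ 3 (BEFORE m); for (F, γ)
take (H, D, A). Per plaquette, Markov/Chernoff on the window: Gibbs_K(θBal(K−j) ≤ dist1(Ū^j(∂p))) ≤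
D·β^A·exp(H t² − t·p) for every 0 ≤ t ≤ β^ε, with p = B10.pFun b₀ p₀ (g_(K−j)) = b₀(1 + ½ log
β_(K−j))^(p₀) (θBal(i) = g_i·p(g_i)); since β ≥ 1 (γ ≤ 1) and log β ≤ β^a/a (Mathlib
`Real.log_le_rpow_div`, a = ε/p₀) we have p ≤ M·β^ε with M = b₀(1 + 1/(2a))^(p₀), so t := p/max(2H,
M) lies in the window and gives exponent ≤ −c·p² with c = 1/(2·max(2H, M)) > 0; this is the
hypothesis of the landed schema `T3AveragedTailProfile.historyTailAt_of_perPlaquette` (C := D, A, c;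
needs 0 < γ ≤ 1, 0 < b₀, 1 ≤ p₀), which returns HistoryTailAt F γ b₀ p₀ m for every m ≥ 1.
Integrability of the bounded integrand: landed
`LargeFieldMassRefinementTailSubGaussianRung.integrable_exp_mul_dist1_iter`. [difficulty:
provable-now] -/
@[route_item "route-QuantumFields-ModerateWindow", crux]
def HistoryTailOfWindow : Prop :=
  open Literature.MathematicalPhysics.QuantumFieldTheory.Balaban1983to89 Literature.MathematicalPhysics.QuantumFieldTheory.Balaban1983to89.T3ContinuumYM3Torus in WindowMGFL → ∀ (L : ℕ) (b₁ p₁ : ℝ), ∃ (b₀ p₀ : ℝ), b₁ ≤ b₀ ∧ p₁ ≤ p₀ ∧ 0 < b₀ ∧ 2 < p₀ ∧ ∀ (m : ℕ), 0 < m → ∃ γ₁ : ℝ, 0 < γ₁ ∧ ∀ (F : T3Family) (γ : ℝ), F.L = L → 0 < γ → γ ≤ γ₁ → T3UnitScaleTilt.HistoryTailAt F γ b₀ p₀ m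

-- `HistoryTailOfWindow` holds: proved by `Summit.QuantumFields.YangMills.Theorems.ModerateWindowHistoryTailOfWindow.historyTailOfWindow` (its module imports this route file, so no `_holds` link can be stated here).

/-- item stmt-QuantumFields-27841 · assembly · rank 1 · closed · proved by Summit.QuantumFields.YangMills.Theorems.moderateWindow_assembly (planner) · by planner
sources: King1986, Balaban1985UV3
[assembly] MinimiserStabilityRegPr → FluctuationComparisonRegPrIntL → WindowMGFL →
HistoryTailOfWindow → the leaf YM3TorusSU2 (rung R3; not the summit Statement); proved in
Sketch8.lean (`assembly_proof`, one line from `closes`). -/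
@[route_item "route-QuantumFields-ModerateWindow"]
def Assembly : Prop :=
  MinimiserStabilityRegPr → FluctuationComparisonRegPrIntL → WindowMGFL → HistoryTailOfWindow → Literature.MathematicalPhysics.QuantumFieldTheory.Balaban1983to89.T3YM3TorusStatement.YM3TorusSU2

-- `Assembly` holds: proved by `Summit.QuantumFields.YangMills.Theorems.moderateWindow_assembly` (its module imports this route file, so no `_holds` link can be stated here).

/-! D-0027 §2.1 — DECIDING THEOREM (planner-authored via `route open/edit --closes-file`; by planner-ym-r3-idea-2-g4-0 2026-08-28T12:23:14Z):
its hypotheses are this route's items and its conclusion the registered leaf `Literature.MathematicalPhysics.QuantumFieldTheory.Balaban1983to89.T3YM3TorusStatement.YM3TorusSU2` (rung R3, D-0061) (glue_lint), and it elaborates with this file. -/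

@[closes "route-QuantumFields-ModerateWindow"] theorem closes (h200 : MinimiserStabilityRegPr) (h201 : FluctuationComparisonRegPrIntL) (hX : WindowMGFL)
    (hG : HistoryTailOfWindow) :
    Literature.MathematicalPhysics.QuantumFieldTheory.Balaban1983to89.T3YM3TorusStatement.YM3TorusSU2 :=
  Summit.QuantumFields.YangMills.Theses.UnitScaleTilt.closes h200 h201 (hG hX)

end Summit.QuantumFields.YangMills.Theses.ModerateWindow
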